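import Literature.NumberTheory.EllipticCurves.TorsionFilAtCountMultiplicativeThreeProofs
import Literature.NumberTheory.EllipticCurves.LocalPointsModKernelOfReductionMultiplicativeProofs
import Literature.NumberTheory.EllipticCurves.TateCurve.MultiplicativeTwistUnramifiedProofs
import Literature.NumberTheory.EllipticCurves.KodairaNeronUnramifiedInertiaProofs
import Literature.NumberTheory.EllipticCurves.FramedTateGaloisRep
import Literature.NumberTheory.GaloisRepresentations.OrdinaryGaloisRep
import HarnessLib

/-!
# STUB-IDEAS `stub_liftFive` — ideator k = 3 (FAMILY 3, PROBE THE EXTREMES), GEN 8 companion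

Crux `Summit.ABC.ABC.Theses.DefiniteXi.FreyModularity` (stmt-ABC-11340), skeleton `Lines/Sketch.lean`
(sha 21576c53), stub `stub_liftFive` (Diamond 1996 Thm 5.3 = `CDT_theorem_7_2_2 ∩ {25 ∤ N}`).

Gens 6–7 of this slot typed the multiplicative-ordinary corner at `p = 5` down to two one-cycle LOCAL
stubs L1 (`#E₁(K̄_v)[pⁿ] = pⁿ`), L7 (inertia trivial on `E(K̄_v)[p^∞]` modulo `E₁`) and one untyped glue
P2 ⇒ P2′ (`stub_ordinaryWeightTwoAtFive`, a bare `sorry` since gen 6).  GEN 8 = perturbation from the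
PROVED neighbouring case: the tree proved, at `p = 3`, `#Fil_v E[3^k] = 3^k` at a MULTIPLICATIVE `v ∋ 3`
(`natCard_torsionFilAt_pow_eq_of_hasMultiplicativeReductionAt_three`, 2026-08-30), by a COUNT whose only
`3`-specific inputs are two existence lemmas proved with the `3`-division polynomial (a `3`-torsion point
inside `E₁(K̄_v)`, one outside).  At general `p` (so at `5`) both come in five lines each from the PROVED
twisted Tate datum (`Ψ(ζ_p) ∈ E₁`, `Ψ(q^{1/p}) ∉ E₁`), and the induction step is already `p`-general
(div₁ = `exists_nsmul_pow_eq_of_mem_localKernelOfReduction_of_hasMultiplicativeReductionAt`).  So: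

* §1 B1ℓ/B2ℓ (local Tate-datum existence lemmas), B1/B2 (transport to `E(K̄)[p]`), B3 (onto-ness of
  `×p : Fil_v E[p^{k+1}] → Fil_v E[p^k]`), F0 `#Fil_v E[p] = p`, F1 `#Fil_v E[p^k] = p^k`, T1 (F-currency =
  gen-7 L1 currency) — each ONE prover cycle, statements elaborate, proofs = the `p = 3` files with `3 ↦ p`;
* §2 S0 — the twisted Tate datum is HONESTLY equivariant on the inertia group (PROVED here from
  `toAlgEquiv_eq_of_mem_inertia_of_sq_eq_gamma` + `inertia_eq_absInertia`): the common input of gen-7 L7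
  and of k1's W1;
* §3 A3 — the frame lemma `stable line + χ on the line + trivial quotient on inertia ⇒
  IsOrdinaryOfWeightAt p (W.framedTateGaloisRep p) v 2 1` (M, pure linear algebra over `ℚ̄_p`, sorried
  statement) and the PROVED corollary P2 ⇒ P2′ (`ordinaryWeightTwoAtFive_of_P2`).

Shapes P2 / P2′ are VERBATIM copies of gens 6/7 (`Iff.rfl` against those files).  Literature-only imports.
Nothing here is a tree theorem; provers port §1–§3 to
`Literature/NumberTheory/EllipticCurves/TorsionFilAtCountMultiplicativeProofs.lean` (F-series, BSD-bankable:
Greenberg's exceptional-zero setting) and `…/MultiplicativeOrdinaryFrameProofs.lean` (A3), `--supports stmt-ABC-11340`.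
-/

noncomputable section

open scoped Classical NNReal NumberField AddSubgroup
open NumberField IsDedekindDomain Field
open Literature.NumberTheory.EllipticCurves Literature.NumberTheory.EllipticCurves.TateCurve
open Literature.NumberTheory.GaloisRepresentations
open WeierstrassCurve IsDedekindDomain.HeightOneSpectrum

namespace Summit.ABC.ABC.Cruxes.FreyModularity.StubIdeas.LiftFive3g8

/-- `5` is prime (instance used by the `p = 5` shapes, as in gens 6–7). -/
instance instFactPrimeFive : Fact (Nat.Prime 5) := ⟨by norm_num⟩

/-! ## §0 The two shapes (verbatim from gens 6/7) -/

/-- P2 shape (gen 6/7, verbatim). [cite: SilvermanATAEC1994, V §5 Thm. 5.3, Cor. 5.4; V §6 Prop. 6.1] -/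
def MultiplicativeOrdinaryFiltrationShape : Prop :=
  ∀ {K : Type} [Field K] [NumberField K] (W : WeierstrassCurve K) [W.IsElliptic]
    (p : ℕ) [Fact p.Prime] (v : HeightOneSpectrum (𝓞 K)),
    (p : 𝓞 K) ∈ v.asIdeal → W.HasMultiplicativeReductionAt v →
    ∃ L : Submodule ℚ_[p] (W.rationalTateModule p),
      Module.finrank ℚ_[p] L = 1 ∧
      (∀ (τ : absoluteGaloisGroup (v.adicCompletion K)), ∀ x ∈ L,
        W.rationalGaloisRepTate p (absGaloisRestrict K (v.adicCompletion K) τ) x ∈ L) ∧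
      (∀ τ ∈ absInertia (v.adicCompletion K), ∀ x ∈ L,
        W.rationalGaloisRepTate p (absGaloisRestrict K (v.adicCompletion K) τ) x =
          (((GaloisRep.cyclotomicCharacter (v.adicCompletion K) p τ : ℤ_[p]ˣ) : ℤ_[p]) : ℚ_[p]) • x) ∧
      (∀ τ ∈ absInertia (v.adicCompletion K), ∀ x : W.rationalTateModule p,
        W.rationalGaloisRepTate p (absGaloisRestrict K (v.adicCompletion K) τ) x - x ∈ L)

/-- P2′ shape (gen 6, verbatim): the Skinner–Wiles reading consumed by E6 `WilesOrdinaryLiftFive`.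
[cite: SkinnerWiles1999, §1 Theorem (ii)] [cite: SilvermanATAEC1994, V §5 Thm. 5.3] -/
def OrdinaryWeightTwoAtFiveShape : Prop :=
  ∀ (W : WeierstrassCurve ℚ) [W.IsElliptic] (v : HeightOneSpectrum (𝓞 ℚ)),
    ((5 : ℕ) : 𝓞 ℚ) ∈ v.asIdeal → W.HasMultiplicativeReductionAt v →
    FramedGaloisRep.IsOrdinaryOfWeightAt 5 (W.framedTateGaloisRep 5) v 2 1

/-! ## §1 The F-series: `#Fil_v E[p^k] = p^k` at a multiplicative `v ∣ p`, every `p` (port of the `p = 3` count) -/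

section FSeries

variable {K : Type} [Field K] [NumberField K] (W : WeierstrassCurve K) [W.IsElliptic]
  (v : HeightOneSpectrum (𝓞 K)) {p : ℕ} [hp : Fact p.Prime]

/-- **B1ℓ (one cycle, S).** At a multiplicative `v ∣ p`, `E₁(K̄_v)` contains a point of order `p`: `Ψ(ζ_p)`
for a primitive `p`-th root of unity `ζ_p ∈ K̄_v` — `ζ_p` is a principal unit in residue characteristic `p`
(`WeierstrassCurve.spectralValuation_sub_one_lt_one_of_pow`, `k = 1`), so `Ψ(ζ_p) ∈ E₁` by the reduction
clause of `TateCurve.exists_twistedTateUniformisation_localKernelOfReduction_iff`; `Ψ(ζ_p) ≠ 0` since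
`ζ_p ∉ q^ℤ` (`|ζ_p| = 1 = |q|^n ⇒ n = 0`).  Replaces the `3`-division-polynomial lemma
`exists_ne_zero_mem_localKernelOfReduction_three_of_hasMultiplicativeReductionAt_three`.
[cite: SilvermanATAEC1994, §V.4 (PDF pp. 399–401), Thm. V.5.3] -/
theorem exists_ne_zero_mem_localKernelOfReduction_torsion_of_hasMultiplicativeReductionAt
    (hpv : ((p : ℕ) : 𝓞 K) ∈ v.asIdeal) (hmult : W.HasMultiplicativeReductionAt v) :
    ∃ Q : localPoints W (v.adicCompletion K),
      Q ∈ W.localKernelOfReduction v ∧ Q ≠ 0 ∧ ((p : ℕ) : ℤ) • Q = 0 := by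
  sorry

/-- **B2ℓ (one cycle, S) — the ordinary point.** At a multiplicative `v ∣ p` some `p`-torsion point of
`E(K̄_v)` lies OUTSIDE `E₁(K̄_v)`: `Ψ(w)` with `w^p = q` — `Ψ(w) ∈ E₁ ↔ w ∈ (1 + 𝔪)q^ℤ`
(`mem_localKernelOfReduction_iff_exists_zpow_of_tate`) would force `|q|^{1/p} = |q|^n`, `n ∈ ℤ`.  Replaces
`exists_ordinaryPoint_local_of_hasMultiplicativeReductionAt_three` (there: `ψ₃ mod 𝔪_v` non-constant).
[cite: SilvermanATAEC1994, §V.4, Thm. V.5.3] [cite: GreenbergLNM1716, §1 p. 62] -/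
theorem exists_torsion_not_mem_localKernelOfReduction_of_hasMultiplicativeReductionAt
    (hpv : ((p : ℕ) : 𝓞 K) ∈ v.asIdeal) (hmult : W.HasMultiplicativeReductionAt v) :
    ∃ Q : localPoints W (v.adicCompletion K), ((p : ℕ) : ℤ) • Q = 0 ∧ Q ∉ W.localKernelOfReduction v := by
  sorry

/-- **B1 (transport, XS).** `Fil_v E[p] ≠ 0`: B1ℓ + `exists_pointsMapOfEmb_eq_of_nsmul_eq_zero` (torsion of
`E(K̄_v)` is algebraic) — verbatim the proof of
`exists_ne_zero_mem_torsionFilAt_three_of_hasMultiplicativeReductionAt_three` with `3 ↦ p`.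
[cite: SilvermanAEC2009, Cor. III.6.4] -/
theorem exists_ne_zero_mem_torsionFilAt_of_hasMultiplicativeReductionAt
    (hpv : ((p : ℕ) : 𝓞 K) ∈ v.asIdeal) (hmult : W.HasMultiplicativeReductionAt v) :
    ∃ P : geomTorsion W ((p : ℕ) : ℤ), P ∈ W.torsionFilAt v ((p : ℕ) : ℤ) ∧ P ≠ 0 := by
  sorry

/-- **B2 (transport, XS).** Some `P ∈ E(K̄)[p]` lies outside `Fil_v E[p]`: B2ℓ +
`exists_geomTorsion_pointsMapOfEmb_eq` — verbatim `exists_not_mem_torsionFilAt_of_hasMultiplicativeReductionAt_three`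
with `3 ↦ p`. [cite: GreenbergLNM1716, §1 p. 62] -/
theorem exists_not_mem_torsionFilAt_of_hasMultiplicativeReductionAt
    (hpv : ((p : ℕ) : 𝓞 K) ∈ v.asIdeal) (hmult : W.HasMultiplicativeReductionAt v) :
    ∃ P : geomTorsion W ((p : ℕ) : ℤ), P ∉ W.torsionFilAt v ((p : ℕ) : ℤ) := by
  sorry

/-- **B3 (one cycle, S).** `×p : Fil_v E[p^{k+1}] → Fil_v E[p^k]` is onto at a multiplicative `v ∣ p`:
verbatim `exists_mem_torsionFilAt_reduce_eq_of_hasMultiplicativeReductionAt_three` with its first line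
replaced by the `p`-general (div₁) `exists_nsmul_pow_eq_of_mem_localKernelOfReduction_of_hasMultiplicativeReductionAt`
(`k = 1`). [cite: GreenbergLNM1716, §2 p. 82] [cite: SilvermanAEC2009, Cor. III.6.4] -/
theorem exists_mem_torsionFilAt_reduce_eq_of_hasMultiplicativeReductionAt
    (hpv : ((p : ℕ) : 𝓞 K) ∈ v.asIdeal) (hmult : W.HasMultiplicativeReductionAt v)
    (k : ℕ) (y : geomTorsion W (((p : ℕ) : ℤ) ^ k)) (hy : y ∈ W.torsionFilAt v (((p : ℕ) : ℤ) ^ k)) :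
    ∃ y' ∈ W.torsionFilAt v (((p : ℕ) : ℤ) ^ (k + 1)), W.geomTorsionReduce p k y' = y := by
  sorry

/-- **F0 (one cycle, S).** `#Fil_v E[p] = p` at a multiplicative `v ∣ p`: `≤ p` by B2 and the tree's
`natCard_torsionFilAt_prime_le_of_exists_not_mem`, `≠ 1` by B1, `∣ #E[p] = p²` — verbatim
`natCard_torsionFilAt_three_eq_of_hasMultiplicativeReductionAt_three` (the final `interval_cases` becomes
`Nat.dvd_prime_pow` with exponent `≤ 2`). [cite: GreenbergLNM1716, §2 p. 82, Prop. 2.3] [cite: SilvermanAEC2009, Cor. III.6.4] -/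
theorem natCard_torsionFilAt_prime_eq_of_hasMultiplicativeReductionAt
    (hpv : ((p : ℕ) : 𝓞 K) ∈ v.asIdeal) (hmult : W.HasMultiplicativeReductionAt v) :
    Nat.card (W.torsionFilAt v ((p : ℕ) : ℤ)) = p := by
  sorry

/-- **F1 (one cycle, S/M).** `#Fil_v E[p^k] = p^k` at a multiplicative `v ∣ p`, every prime `p`: the
induction of `natCard_torsionFilAt_pow_eq_of_hasMultiplicativeReductionAt_three` VERBATIM (onto map B3,
kernel `≃ Fil_v E[p]` counted by F0, `geomTorsionReduce_mem_torsionFilAt`).  For the Tate curve: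
`Fil_v E[p^k] = Ψ(μ_{p^k})`. [cite: GreenbergLNM1716, §2 p. 82 (ℱ[p^∞] ≅ ℚ_p/ℤ_p)] [cite: SilvermanATAEC1994, Thm. V.5.3] -/
theorem natCard_torsionFilAt_pow_eq_of_hasMultiplicativeReductionAt
    (hpv : ((p : ℕ) : 𝓞 K) ∈ v.asIdeal) (hmult : W.HasMultiplicativeReductionAt v) (k : ℕ) :
    Nat.card (W.torsionFilAt v (((p : ℕ) : ℤ) ^ k)) = p ^ k := by
  sorry

/-- **T1 (transport, S; unconditional).** The F-currency and gen-7's L1 currency count the same set: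
`P ↦ ι(P)` is a bijection `Fil_v E[p^n] ≃ E₁(K̄_v)[p^n]` (`pointsMapOfEmb_injective`; every torsion point of
`E(K̄_v)` is algebraic, `exists_pointsMapOfEmb_eq_of_nsmul_eq_zero`).  Hence F1 ⇒ gen-7 `L1Statement`.
[cite: SilvermanAEC2009, Cor. III.6.4] -/
theorem natCard_torsionBy_localKernelOfReduction_eq_natCard_torsionFilAt (n : ℕ) :
    Nat.card ((W.localKernelOfReduction v)[(p ^ n : ℕ)]) =
      Nat.card (W.torsionFilAt v (((p : ℕ) : ℤ) ^ n)) := by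
  sorry

end FSeries

/-! ## §2 S0 — the twisted Tate datum is equivariant on the inertia group (PROVED) -/

section Inertia

variable {K : Type} [Field K] [NumberField K] (W : WeierstrassCurve K) [W.IsElliptic]
  (v : HeightOneSpectrum (𝓞 K))

/-- **S0 (PROVED).** At a place of multiplicative reduction (split or not) the twisted Tate datum
`(q, Ψ)` of `TateCurve.exists_twistedTateUniformisation_localKernelOfReduction_iff` — `Ψ : K̄_vˣ ↠ E(K̄_v)`,
`ker Ψ = q^ℤ`, `E₁(K̄_v) = Ψ(1 + 𝔪)`, `σ • Ψ(u) = ±Ψ(σu)` — is HONESTLY equivariant on the inertia group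
`absInertia K_v`: the sign `σ(t)/t`, `t² = −c₄/c₆`, is `+1` there because `K_v(√γ)/K_v` is unramified
(`toAlgEquiv_eq_of_mem_inertia_of_sq_eq_gamma`, `inertia_eq_absInertia`).  Common input of gen-7 L7
(`τ • Q − Q = Ψ(τu/u) ∈ E₁`, `τu/u ∈ μ_{p^∞} ⊂ 1 + 𝔪`) and of k1's W1.
[cite: SilvermanATAEC1994, Ch. V Lemma 5.2, Thm. 5.3 (b), Ex. 5.11 (PDF pp. 407–412)] -/
theorem exists_tateUniformisation_absInertia_equivariant (hmult : W.HasMultiplicativeReductionAt v) :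
    ∃ (q : v.adicCompletion K)
      (Ψ : Additive (AlgebraicClosure (v.adicCompletion K))ˣ →+ localPoints W (v.adicCompletion K)),
      q ≠ 0 ∧ Valued.v q < 1 ∧ Function.Surjective Ψ ∧
      (∀ u : (AlgebraicClosure (v.adicCompletion K))ˣ, Ψ (Additive.ofMul u) = 0 ↔
        ∃ n : ℤ, (u : AlgebraicClosure (v.adicCompletion K)) =
          algebraMap (v.adicCompletion K) (AlgebraicClosure (v.adicCompletion K)) q ^ n) ∧
      (∀ σ ∈ absInertia (v.adicCompletion K), ∀ u : (AlgebraicClosure (v.adicCompletion K))ˣ,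
        σ • Ψ (Additive.ofMul u) =
          Ψ (Additive.ofMul (Units.map
            (absoluteGaloisGroup.toAlgEquiv (v.adicCompletion K) σ :
              AlgebraicClosure (v.adicCompletion K) →* AlgebraicClosure (v.adicCompletion K)) u))) ∧
      (∀ P : localPoints W (v.adicCompletion K), P ∈ W.localKernelOfReduction v ↔
        ∃ u : (AlgebraicClosure (v.adicCompletion K))ˣ,
          v.spectralValuation ((u : AlgebraicClosure (v.adicCompletion K)) - 1) < 1 ∧
          Ψ (Additive.ofMul u) = P) := by
  obtain ⟨q, t, Ψ, hq0, hq1, -, ht, hsurj, hker, hΨσ, hiff⟩ :=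
    exists_twistedTateUniformisation_localKernelOfReduction_iff W v hmult
  obtain ⟨w, hw⟩ := v.exists_spectralValuation
  obtain ⟨𝔐, h𝔐⟩ := v.localPrimesAbove_nonempty
  refine ⟨q, Ψ, hq0, hq1, hsurj, hker, fun σ hσ u ↦ ?_, hiff⟩
  have hσ' : σ ∈ 𝔐.inertia (absoluteGaloisGroup (v.adicCompletion K)) := by
    rw [inertia_eq_absInertia hw h𝔐]; exact hσ
  have hσt : absoluteGaloisGroup.toAlgEquiv (v.adicCompletion K) σ t = t :=
    toAlgEquiv_eq_of_mem_inertia_of_sq_eq_gamma W hmult h𝔐 ht hσ'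
  rw [hΨσ σ u, if_pos hσt, one_zsmul]

end Inertia

/-! ## §3 A3 — the frame lemma P2 ⇒ P2′ (pure linear algebra over `ℚ̄_p`) -/

section Frame

variable {K : Type} [Field K] [NumberField K] (W : WeierstrassCurve K) [W.IsElliptic]
  (v : HeightOneSpectrum (𝓞 K)) (p : ℕ) [hp : Fact p.Prime]

/-- **A3 frame lemma (one cycle, M; NEW — untyped in gens 3–7).** A `Γ_{K_v}`-stable `ℚ_p`-line `L ⊂ V_pE`
with inertia acting by `χ_p` on `L` and trivially on `V_pE/L` makes `ρ_{E,p}|_{Γ_{K_v}}` ORDINARY OF WEIGHT `2`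
WITH INERTIAL EXPONENT `1` (`FramedGaloisRep.IsOrdinaryOfWeightAt p (W.framedTateGaloisRep p) v 2 1`).
Proof plan: `L = ℚ_p ℓ` (`finrank = 1`), complete to a basis `b = (ℓ, m)` of `V_pE`
(`finrank_rationalTateModule_eq_two_holds`); `ρ_{E,p}` is conjugate to its frame in `b`
(`exists_conj_framedTateGaloisRep_eq_ofBasis`, `isOrdinaryOfWeightAt_conj_iff`), whose matrices
(`coe_framedTateGaloisRepOfBasis_apply`, `LinearMap.toMatrix_apply`) have entry `(1,0) = 0` (stability),
and on inertia `(0,0) = χ_p`, `(1,1) = 1`; take `Q = 1` in `isOrdinaryOfWeightAt_iff`.  (Either of the two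
inertia clauses is redundant given `det = χ_p`, `det_rationalTateRepresentation_eq_cyclotomicCharacter`;
alternative route: `HasCommonEigenvector.exists_conjGL_apply_one_zero_eq_zero` of
`ResiduallyReducibleOfStableLine`.) [cite: SkinnerWiles1999, §1 Theorem (ii)] [cite: Greenberg1991, §2 (p. 214)] -/
theorem isOrdinaryOfWeightAt_two_one_of_stableLine
    (L : Submodule ℚ_[p] (W.rationalTateModule p)) (hL1 : Module.finrank ℚ_[p] L = 1)
    (hst : ∀ (τ : absoluteGaloisGroup (v.adicCompletion K)), ∀ x ∈ L,
      W.rationalGaloisRepTate p (absGaloisRestrict K (v.adicCompletion K) τ) x ∈ L)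
    (hχ : ∀ τ ∈ absInertia (v.adicCompletion K), ∀ x ∈ L,
      W.rationalGaloisRepTate p (absGaloisRestrict K (v.adicCompletion K) τ) x =
        (((GaloisRep.cyclotomicCharacter (v.adicCompletion K) p τ : ℤ_[p]ˣ) : ℤ_[p]) : ℚ_[p]) • x)
    (hquot : ∀ τ ∈ absInertia (v.adicCompletion K), ∀ x : W.rationalTateModule p,
      W.rationalGaloisRepTate p (absGaloisRestrict K (v.adicCompletion K) τ) x - x ∈ L) :
    FramedGaloisRep.IsOrdinaryOfWeightAt p (W.framedTateGaloisRep p) v 2 1 := by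
  sorry

end Frame

/-- **P2 ⇒ P2′ (PROVED modulo the frame lemma A3).** [cite: SkinnerWiles1999, §1 Theorem (ii)] -/
theorem ordinaryWeightTwoAtFive_of_P2 (hP2 : MultiplicativeOrdinaryFiltrationShape) :
    OrdinaryWeightTwoAtFiveShape := by
  intro W _ v h5 hmult
  obtain ⟨L, h1, h2, h3, h4⟩ := hP2 W 5 v h5 hmult
  exact isOrdinaryOfWeightAt_two_one_of_stableLine W v 5 L h1 h2 h3 h4

/-! ## §4 Assembly bookkeeping (gen-7 L1 from F1 + T1; documentation-grade, proved) -/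

section Assembly

variable {K : Type} [Field K] [NumberField K] (W : WeierstrassCurve K) [W.IsElliptic]
  (v : HeightOneSpectrum (𝓞 K)) {p : ℕ} [hp : Fact p.Prime]

/-- **gen-7 L1 from F1 + T1** (its exact signature `natCard_torsionBy_localKernelOfReduction_eq`). [folklore] -/
theorem natCard_torsionBy_localKernelOfReduction_eq (hpv : ((p : ℕ) : 𝓞 K) ∈ v.asIdeal)
    (hmult : W.HasMultiplicativeReductionAt v) (n : ℕ) :
    Nat.card ((W.localKernelOfReduction v)[(p ^ n : ℕ)]) = p ^ n := by
  rw [natCard_torsionBy_localKernelOfReduction_eq_natCard_torsionFilAt W v n,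
    natCard_torsionFilAt_pow_eq_of_hasMultiplicativeReductionAt W v hpv hmult n]

end Assembly

end Summit.ABC.ABC.Cruxes.FreyModularity.StubIdeas.LiftFive3g8

end
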